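import Summits.BirchSwinnertonDyer.BirchSwinnertonDyer.Theses.PrintCf2RubinValueTwo
import Literature.NumberTheory.ComplexMultiplication.EllipticUnits.ImaginaryQuadraticMainConjectureCarriersExist
import HarnessLib

/-!
# Route C (`PrintCf2RubinValueTwo`) support item F0a `IwasawaCohomologyDataExists` — CLOSED

The pinned Johnson-Leung–Kings carriers `H^i(𝒪_K[1/p𝔣], Λ(χ)(1)) = lim←_{n,k} H^i(G_S(K̃_n), μ_{p^k} ⊗ θ)`,
`i = 0, 1, 2` (ty2 g37's `JohnsonLeungKings2011.IwasawaCohomologyData`, p723221) EXIST for every number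
field, prime, pair of `ℤ_p`-extensions, pair of group elements, character and modulus: the Literature
construction `JohnsonLeungKings2011.iwasawaCohomologyDataExists`
(`ImaginaryQuadraticMainConjectureCarriersExist.lean`, width seat `bsd-line-cf2-p1-w5` g9), whose TYPE is
the route decl verbatim. Cell `bsd-print-cf2`, item `stmt-BirchSwinnertonDyer-24745`.
-/

namespace Summit.BirchSwinnertonDyer.BirchSwinnertonDyer.Theorems

/-- **F0a: the pinned carriers `H⁰, H¹, H²` of [JLK 2011] Def. 4.2 (94) / Cor. 5.3 exist, unconditionally**
(route decl `Theses.PrintCf2RubinValueTwo.IwasawaCohomologyDataExists`, item stmt-BirchSwinnertonDyer-24745),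
by the compatible-families construction `JohnsonLeungKings2011.iwasawaCohomologyData`. -/
theorem iwasawaCohomologyDataExists_proof :
    Summit.BirchSwinnertonDyer.BirchSwinnertonDyer.Theses.PrintCf2RubinValueTwo.IwasawaCohomologyDataExists := by
  unfold Summit.BirchSwinnertonDyer.BirchSwinnertonDyer.Theses.PrintCf2RubinValueTwo.IwasawaCohomologyDataExists
  exact Literature.NumberTheory.ComplexMultiplication.EllipticUnits.JohnsonLeungKings2011.iwasawaCohomologyDataExists

end Summit.BirchSwinnertonDyer.BirchSwinnertonDyer.Theorems
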